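import Summits.QuantumFields.YangMills.Theorems.ToronSmallBallOwnAxisShiftBasic
import Summits.QuantumFields.YangMills.Theorems.ToronSmallBallOwnAxisShiftLadder
import Summits.QuantumFields.YangMills.Theorems.ToronSmallBallSiteTwistTime
import Summits.QuantumFields.YangMills.Theorems.QuantileBitPuritySectorDensity
import HarnessLib

/-!
# The own-axis sheet shift: the second-order cost of the shift on one slice, one bond and the whole ring

Support module (`--supports` stmt-QuantumFields-24089, `ToronSmallBall.PeriodicOffCoreStripWindowDeep`; seat ym-dw-p1 g15).  Quantities on one slice
`U` of the spatial torus `(ℤ/L)³` (`q = su2Quat`): a NON-CENTRALITY FLOOR `σ ≤ ‖Im q(P_x)‖` for every plane line `x₀ = 0`, a uniform PLAQUETTE bound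
`‖q(U_p) − 1‖ ≤ ε` (the square root of the deficit), and for two slices a uniform LINK closeness `‖q(U_e) − q(V_e)‖ ≤ τ`.  We prove:

* (ladders: module `ToronSmallBallOwnAxisShiftLadder`);
* §2 ★ `re_trace_plaquette_ownShift_ge`: every plane plaquette changes by at most `(2|θ|Lε/σ)² + 2·(2|θ|Lε/σ)·ε` — SECOND ORDER (module
  `ToronSmallBallOwnAxisShiftLocal`): `Re tr` of the shifted plaquette is `Re tr(h_P h_Q⁻¹ U_p)` with `Q` the transported neighbouring holonomy;
  ★ `wilsonAction_ownShift_sub_le`: `S(ownShift θ U) − S(U) ≤ #P · ((2θLε/σ)² + 4|θ|Lε²/σ)`;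
* §3 ★ `timeCoupling_ownShift_ge`: `T(ownShift θ U, ownShift θ V) ≥ T(U,V) − #E · ((2θLτ/σ)² + 4|θ|Lτ²/σ)`;
* §4 ★ `seamDensity_le_exp_mul_ownShift`: on the ring of `n+1` slices closed through the UNTWISTED seam `(U_n, g·U_0)`, on the event
  «floor `σ`, plaquettes `ε`, bonds and seam `τ`», the sector density satisfies `w₀(U⃗, g) ≤ exp(Q) · w₀((ownShift θ U_t)_t, g)` with
  `Q = β(n+1)(#P·plaq + #E·time)` — the cost hypothesis of the translate argument (gauge covariance `ownShift θ (g·U) = g·ownShift θ U` makes the seam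
  an ordinary bond).

HONEST FRAMING: fixed-lattice inequalities; nothing about infinite volume, the continuum limit or the Clay gap.  No `sorry`, no new axiom, no new
definition.  References: [cite: Luscher1983, §2]; [cite: tHooft1979]; [cite: SeilerLNP1982, §3].
-/

set_option autoImplicit false

noncomputable section

open scoped Quaternion BigOperators
open NormedSpace Function
open Literature.MathematicalPhysics.QuantumLattice (su2Quat su2Quat_ne_zero norm_su2Quat fundamentalRep_apply)
open Literature.MathematicalPhysics.QuantumFieldTheory hiding su2Quat_mul
open Literature.MathematicalPhysics.QuantumFieldTheory.Balaban1983to89.T4HaarSU2ExpChart (expPoint)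
open Literature.MathematicalPhysics.QuantumFieldTheory.Balaban1983to89.T4HaarSU2Translate (su2Quat_mul su2Quat_one)

namespace Summit.QuantumFields.YangMills.Theorems.FemtoTransferGap.OwnAxis

open ClassShift

variable {L : ℕ}

/-! ## §2 The plaquette cost -/

section Plaquette

variable [NeZero L]

/-- Monotonicity of the second-order bound in the defect `D` and in the distance `m`. [folklore] -/
theorem secondOrder_mono {θ D D' m m' r : ℝ} (hD : 0 ≤ D) (hDD : D ≤ D') (hm : 0 ≤ m) (hmm : m ≤ m') (hθ : 0 ≤ θ)
    (h : r - (θ * D) ^ 2 - 2 * (θ * D) * m ≤ 0) : r - (θ * D') ^ 2 - 2 * (θ * D') * m' ≤ 0 := by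
  have hD' : 0 ≤ θ * D' := mul_nonneg hθ (hD.trans hDD)
  have h1 : (θ * D) ^ 2 ≤ (θ * D') ^ 2 := pow_le_pow_left₀ (mul_nonneg hθ hD) (mul_le_mul_of_nonneg_left hDD hθ) 2
  have h2 : 2 * (θ * D) * m ≤ 2 * (θ * D') * m' := by
    have : θ * D * m ≤ θ * D' * m' := mul_le_mul (mul_le_mul_of_nonneg_left hDD hθ) hmm hm hD'
    linarith
  linarith

/-- ★ **Every plane plaquette changes at second order under the own-axis shift**: for a plane site `x` (`x₀ = 0`), `j ≠ 0`, a floor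
`σ ≤ ‖Im q(P_y)‖` on the plane lines and a uniform plaquette bound `‖q(U_p) − 1‖ ≤ ε`,
`Re tr (ownShift θ U)_{x;0,j} ≥ Re tr U_{x;0,j} − (2|θ|Lε/σ)² − 2(2|θ|Lε/σ)ε`. [cite: Luscher1983, §2] -/
theorem re_trace_plaquette_ownShift_ge (θ : ℝ) {σ ε : ℝ} (hσ : 0 < σ) (U : GaugeConfig 3 L SU2)
    (hNC : ∀ y : Site 3 L, y 0 = 0 → σ ≤ ‖imVec (su2Quat (lineHolonomy U 0 L y))‖)
    (hP : ∀ (y : Site 3 L) (i j : Fin 3), ‖su2Quat (plaquetteHolonomy U y i j) - 1‖ ≤ ε)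
    {x : Site 3 L} (hx : x 0 = 0) {j : Fin 3} (hj : j ≠ 0) :
    (((plaquetteHolonomy U x 0 j : SU2) : Matrix (Fin 2) (Fin 2) ℂ).trace).re - (|θ| * (2 * (L * ε) / σ)) ^ 2 - 2 * (|θ| * (2 * (L * ε) / σ)) * ε ≤
      (((plaquetteHolonomy (ownShift θ U) x 0 j : SU2) : Matrix (Fin 2) (Fin 2) ℂ).trace).re := by
  have hε : 0 ≤ ε := (norm_nonneg _).trans (hP x 0 j)
  -- the objects
  set P : SU2 := lineHolonomy U 0 L x with hPdef
  set A : SU2 := U (x, 0) * U (x.shift 0, j) * (U (x.shift j, 0))⁻¹ with hA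
  set Q : SU2 := A * lineHolonomy U 0 L (x.shift j) * A⁻¹ with hQ
  set M : SU2 := plaquetteHolonomy U x 0 j with hM
  have hxj : (x.shift j) 0 = 0 := by
    have : (x.shift j) 0 = x 0 := by simp [Site.shift, Pi.single_eq_of_ne (Ne.symm hj)]
    rw [this, hx]
  -- non-centrality of `P` and of the transported `Q`
  have hPnc : imVec (su2Quat P) ≠ 0 := fun h => by
    have := hNC x hx; rw [← hPdef, h, norm_zero] at this; linarith
  have hQnorm : ‖imVec (su2Quat Q)‖ = ‖imVec (su2Quat (lineHolonomy U 0 L (x.shift j)))‖ := by rw [hQ, norm_imVec_su2Quat_conj]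
  have hQnc : imVec (su2Quat Q) ≠ 0 := fun h => by
    have := hNC _ hxj; rw [← hQnorm, h, norm_zero] at this; linarith
  -- the shifted plaquette in the trace: `Re tr(h_P · h_Q⁻¹ · M)`
  have htr : (((plaquetteHolonomy (ownShift θ U) x 0 j : SU2) : Matrix (Fin 2) (Fin 2) ℂ).trace).re =
      (((expPoint (θ • axisVec P) * (expPoint (θ • axisVec Q))⁻¹ * M : SU2) : Matrix (Fin 2) (Fin 2) ℂ).trace).re := by
    have h1 := trace_plaquetteHolonomy_siteTwist_fst su2Rep 0 (ownAxisField θ U) U x hj.symm hx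
    rw [← ownShift_def] at h1
    simp only [fundamentalRep_apply] at h1
    rw [h1]
    -- `h(x+e_j)` conjugated by `A` is the rotation about the transported axis
    have hconj : A * ownAxisField θ U (x.shift j) * A⁻¹ = expPoint (θ • axisVec Q) := by
      rw [ownAxisField_apply, hQ, expPoint_axisVec_conj]
    have hW : A * ((ownAxisField θ U (x.shift j))⁻¹ * (U (x, j))⁻¹ * ownAxisField θ U x) =
        (ownAxisField θ U x)⁻¹ * (expPoint (θ • axisVec P) * (expPoint (θ • axisVec Q))⁻¹ * M) * ownAxisField θ U x := by
      rw [← hconj, ownAxisField_apply θ U x, ← hPdef, hM, hA]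
      unfold plaquetteHolonomy
      group
    rw [show U (x, 0) * U (x.shift 0, j) * (U (x.shift j, 0))⁻¹ = A from rfl, hW, Submonoid.coe_mul, Submonoid.coe_mul,
      Matrix.trace_mul_cycle, ← Submonoid.coe_mul, mul_inv_cancel, OneMemClass.coe_one, Matrix.one_mul]
  rw [htr]
  -- the local second-order estimate, then monotonicity in the defect
  have hloc := re_trace_rot_mul_rot_inv_mul_ge θ hPnc hQnc M
  have hD : 2 * ‖su2Quat P - su2Quat Q‖ / ‖imVec (su2Quat P)‖ ≤ 2 * (L * ε) / σ := by
    have hσP : σ ≤ ‖imVec (su2Quat P)‖ := hNC x hx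
    have hlad : ‖su2Quat P - su2Quat Q‖ ≤ L * ε := by
      rw [norm_sub_rev, hQ, hA, hPdef]
      exact (norm_su2Quat_conjA_sub_le U j x).trans (ladder_sum_le hP j (x.shift 0))
    calc 2 * ‖su2Quat P - su2Quat Q‖ / ‖imVec (su2Quat P)‖ ≤ 2 * (L * ε) / ‖imVec (su2Quat P)‖ :=
          div_le_div_of_nonneg_right (by linarith) (hσ.le.trans hσP)
      _ ≤ 2 * (L * ε) / σ := div_le_div_of_nonneg_left (by positivity) hσ hσP
  have hm : ‖su2Quat M - 1‖ ≤ ε := hP x 0 j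
  have h0 := secondOrder_mono (r := ((M : Matrix (Fin 2) (Fin 2) ℂ).trace.re -
      (((expPoint (θ • axisVec P) * (expPoint (θ • axisVec Q))⁻¹ * M : SU2) : Matrix (Fin 2) (Fin 2) ℂ).trace).re))
    (by positivity) hD (norm_nonneg _) hm (abs_nonneg θ) (by linarith)
  linarith

/-- The number of plaquettes of the three-torus. [folklore] -/
theorem card_plaquette_pos : 0 < Fintype.card (Plaquette 3 L) := by
  refine Fintype.card_pos_iff.2 ⟨((fun _ => 0), ⟨((0 : Fin 3), (1 : Fin 3)), by decide⟩)⟩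

/-- ★ **Action cost of the own-axis shift on one slice**: `S(ownShift θ U) − S(U) ≤ #P · ((2|θ|Lε/σ)² + 2(2|θ|Lε/σ)ε)`. [cite: Luscher1983, §2] [cite: Wilson1974] -/
theorem wilsonAction_ownShift_sub_le (θ : ℝ) {σ ε : ℝ} (hσ : 0 < σ) (U : GaugeConfig 3 L SU2)
    (hNC : ∀ y : Site 3 L, y 0 = 0 → σ ≤ ‖imVec (su2Quat (lineHolonomy U 0 L y))‖)
    (hP : ∀ (y : Site 3 L) (i j : Fin 3), ‖su2Quat (plaquetteHolonomy U y i j) - 1‖ ≤ ε) :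
    wilsonAction su2Rep (ownShift θ U) - wilsonAction su2Rep U ≤
      Fintype.card (Plaquette 3 L) * ((|θ| * (2 * (L * ε) / σ)) ^ 2 + 2 * (|θ| * (2 * (L * ε) / σ)) * ε) := by
  have hε : 0 ≤ ε := (norm_nonneg _).trans (hP 0 0 1)
  set b : ℝ := (|θ| * (2 * (L * ε) / σ)) ^ 2 + 2 * (|θ| * (2 * (L * ε) / σ)) * ε with hb
  have hb0 : 0 ≤ b := by positivity
  rw [ownShift_def, wilsonAction_siteTwist_sub su2Rep 0 (ownAxisField θ U) U, ← ownShift_def]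
  have hterm : ∀ p ∈ Finset.univ.filter (fun p : Plaquette 3 L => p.1 0 = 0 ∧ (p.2.1.1 = 0 ∨ p.2.1.2 = 0)),
      (su2Rep (plaquetteHolonomy U p.1 p.2.1.1 p.2.1.2)).trace.re - (su2Rep (plaquetteHolonomy (ownShift θ U) p.1 p.2.1.1 p.2.1.2)).trace.re ≤ b := by
    intro p hp
    obtain ⟨hx, hij⟩ := (Finset.mem_filter.1 hp).2
    have hlt : p.2.1.1 < p.2.1.2 := p.2.2
    have hi0 : p.2.1.1 = 0 := by
      rcases hij with h | h
      · exact h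
      · exfalso; rw [h] at hlt; exact (Fin.not_lt_zero _) hlt
    have hj0 : p.2.1.2 ≠ 0 := by intro h; rw [h] at hlt; exact (Fin.not_lt_zero _) hlt
    simp only [fundamentalRep_apply]
    rw [hi0]
    have h := re_trace_plaquette_ownShift_ge θ hσ U hNC hP hx hj0
    linarith
  calc ∑ p ∈ Finset.univ.filter (fun p : Plaquette 3 L => p.1 0 = 0 ∧ (p.2.1.1 = 0 ∨ p.2.1.2 = 0)),
        ((su2Rep (plaquetteHolonomy U p.1 p.2.1.1 p.2.1.2)).trace.re - (su2Rep (plaquetteHolonomy (ownShift θ U) p.1 p.2.1.1 p.2.1.2)).trace.re)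
      ≤ ∑ p ∈ Finset.univ.filter (fun p : Plaquette 3 L => p.1 0 = 0 ∧ (p.2.1.1 = 0 ∨ p.2.1.2 = 0)), b := Finset.sum_le_sum hterm
    _ = (Finset.univ.filter (fun p : Plaquette 3 L => p.1 0 = 0 ∧ (p.2.1.1 = 0 ∨ p.2.1.2 = 0))).card * b := by
        rw [Finset.sum_const, nsmul_eq_mul]
    _ ≤ Fintype.card (Plaquette 3 L) * b := by
        refine mul_le_mul_of_nonneg_right ?_ hb0
        exact_mod_cast Finset.card_le_univ _

end Plaquette

/-! ## §3 The time-like cost -/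

section Time

variable [NeZero L]

/-- ★ **Time-coupling cost of shifting two consecutive slices along their own axes**: with floors `σ` on the plane lines of `U` and `V` and a uniform
link closeness `‖q(U_e) − q(V_e)‖ ≤ τ`,
`T(ownShift θ U, ownShift θ V) ≥ T(U,V) − #E · ((2|θ|Lτ/σ)² + 2(2|θ|Lτ/σ)τ)`. [cite: SeilerLNP1982, §3] [cite: Luscher1983, §2] -/
theorem timeCoupling_ownShift_ge (θ : ℝ) {σ τ : ℝ} (hσ : 0 < σ) (U V : GaugeConfig 3 L SU2)
    (hNCU : ∀ y : Site 3 L, y 0 = 0 → σ ≤ ‖imVec (su2Quat (lineHolonomy U 0 L y))‖)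
    (hNCV : ∀ y : Site 3 L, y 0 = 0 → σ ≤ ‖imVec (su2Quat (lineHolonomy V 0 L y))‖)
    (hT : ∀ e : Edge 3 L, ‖su2Quat (U e) - su2Quat (V e)‖ ≤ τ) :
    timeCoupling su2Rep U V - Fintype.card (Edge 3 L) * ((|θ| * (2 * (L * τ) / σ)) ^ 2 + 2 * (|θ| * (2 * (L * τ) / σ)) * τ) ≤
      timeCoupling su2Rep (ownShift θ U) (ownShift θ V) := by
  have hτ : 0 ≤ τ := (norm_nonneg _).trans (hT ((0 : Site 3 L), 0))
  set b : ℝ := (|θ| * (2 * (L * τ) / σ)) ^ 2 + 2 * (|θ| * (2 * (L * τ) / σ)) * τ with hb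
  have hb0 : 0 ≤ b := by positivity
  have hsub := timeCoupling_siteTwist_siteTwist_sub su2Rep 0 (ownAxisField θ U) (ownAxisField θ V) U V
  rw [← ownShift_def, ← ownShift_def] at hsub
  have hterm : ∀ e ∈ Finset.univ.filter (fun e : Edge 3 L => e.2 = 0 ∧ e.1 0 = 0),
      -b ≤ (su2Rep (U e * (V e)⁻¹ * ((ownAxisField θ V e.1)⁻¹ * ownAxisField θ U e.1))).trace.re - (su2Rep (U e * (V e)⁻¹)).trace.re := by
    intro e he
    obtain ⟨-, hx⟩ := (Finset.mem_filter.1 he).2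
    simp only [fundamentalRep_apply]
    set P : SU2 := lineHolonomy U 0 L e.1 with hP
    set Q : SU2 := lineHolonomy V 0 L e.1 with hQ
    set M : SU2 := U e * (V e)⁻¹ with hM
    have hPnc : imVec (su2Quat P) ≠ 0 := fun h => by
      have := hNCU e.1 hx; rw [← hP, h, norm_zero] at this; linarith
    have hQnc : imVec (su2Quat Q) ≠ 0 := fun h => by
      have := hNCV e.1 hx; rw [← hQ, h, norm_zero] at this; linarith
    have hcyc : ((M * ((ownAxisField θ V e.1)⁻¹ * ownAxisField θ U e.1) : SU2) : Matrix (Fin 2) (Fin 2) ℂ).trace.re =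
        ((((expPoint (θ • axisVec Q))⁻¹ * expPoint (θ • axisVec P) * M : SU2) : Matrix (Fin 2) (Fin 2) ℂ).trace).re := by
      rw [ownAxisField_apply, ownAxisField_apply, ← hP, ← hQ, Submonoid.coe_mul, Matrix.trace_mul_comm, ← Submonoid.coe_mul, ← mul_assoc]
    rw [hcyc]
    have hloc := re_trace_rot_inv_mul_rot_mul_ge θ hPnc hQnc M
    have hD : 2 * ‖su2Quat P - su2Quat Q‖ / ‖imVec (su2Quat P)‖ ≤ 2 * (L * τ) / σ := by
      have hσP : σ ≤ ‖imVec (su2Quat P)‖ := hNCU e.1 hx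
      have hlad : ‖su2Quat P - su2Quat Q‖ ≤ L * τ := norm_su2Quat_lineHolonomy_sub_le_mul hT e.1
      calc 2 * ‖su2Quat P - su2Quat Q‖ / ‖imVec (su2Quat P)‖ ≤ 2 * (L * τ) / ‖imVec (su2Quat P)‖ :=
            div_le_div_of_nonneg_right (by linarith) (hσ.le.trans hσP)
        _ ≤ 2 * (L * τ) / σ := div_le_div_of_nonneg_left (by positivity) hσ hσP
    have hm : ‖su2Quat M - 1‖ ≤ τ := by rw [hM, ← norm_su2Quat_sub_eq]; exact hT e
    have h0 := secondOrder_mono (r := ((M : Matrix (Fin 2) (Fin 2) ℂ).trace.re -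
        ((((expPoint (θ • axisVec Q))⁻¹ * expPoint (θ • axisVec P) * M : SU2) : Matrix (Fin 2) (Fin 2) ℂ).trace).re))
      (by positivity) hD (norm_nonneg _) hm (abs_nonneg θ) (by linarith)
    linarith
  have hsum : -(Fintype.card (Edge 3 L) * b) ≤ ∑ e ∈ Finset.univ.filter (fun e : Edge 3 L => e.2 = 0 ∧ e.1 0 = 0),
      ((su2Rep (U e * (V e)⁻¹ * ((ownAxisField θ V e.1)⁻¹ * ownAxisField θ U e.1))).trace.re - (su2Rep (U e * (V e)⁻¹)).trace.re) := by
    have h1 : ∑ e ∈ Finset.univ.filter (fun e : Edge 3 L => e.2 = 0 ∧ e.1 0 = 0), (-b) ≤ _ := Finset.sum_le_sum hterm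
    rw [Finset.sum_const, smul_neg, nsmul_eq_mul] at h1
    refine le_trans ?_ h1
    have hc : ((Finset.univ.filter (fun e : Edge 3 L => e.2 = 0 ∧ e.1 0 = 0)).card : ℝ) ≤ Fintype.card (Edge 3 L) := by
      exact_mod_cast Finset.card_le_univ _
    nlinarith
  linarith

end Time

/-! ## §4 The whole ring through the untwisted seam -/

section RingCost

variable [NeZero L]

omit [NeZero L] in
/-- Non-centrality floors are gauge invariant: `‖Im q(P_x(g·U))‖ = ‖Im q(P_x(U))‖`. [folklore] -/
theorem norm_imVec_lineHolonomy_gaugeTransform (g : Site 3 L → SU2) (U : GaugeConfig 3 L SU2) (x : Site 3 L) :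
    ‖imVec (su2Quat (lineHolonomy (gaugeTransform g U) 0 L x))‖ = ‖imVec (su2Quat (lineHolonomy U 0 L x))‖ := by
  rw [lineHolonomy_gaugeTransform_closed, norm_imVec_su2Quat_conj]

/-- ★ **The cost of the own-axis shift of every slice, as one exponent.**  On the ring of `n+1` slices closed through the untwisted seam
`(U_n, g·U_0)`, assume: floors `σ ≤ ‖Im q(P_x(U_t))‖` on every plane line of every slice, uniform plaquette bounds `‖q((U_t)_p) − 1‖ ≤ ε`,
and uniform closeness `τ` of every interior bond and of the seam bond (in quaternion norm).  Then for `β ≥ 0`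
`w₀(U⃗, g) ≤ exp(β(n+1)(#P·b_P + #E·b_T)) · w₀((ownShift θ U_t)_t, g)` with `b_P = (2|θ|Lε/σ)² + 4|θ|Lε²/σ`, `b_T = (2|θ|Lτ/σ)² + 4|θ|Lτ²/σ`.
[cite: Luscher1983, §2] [cite: SeilerLNP1982, §3] -/
theorem seamDensity_le_exp_mul_ownShift {β : ℝ} (hβ : 0 ≤ β) (θ : ℝ) {σ ε τ : ℝ} (hσ : 0 < σ) {n : ℕ}
    (Us : Fin (n + 1) → GaugeConfig 3 L SU2) (g : Site 3 L → SU2)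
    (hNC : ∀ (t : Fin (n + 1)) (y : Site 3 L), y 0 = 0 → σ ≤ ‖imVec (su2Quat (lineHolonomy (Us t) 0 L y))‖)
    (hP : ∀ (t : Fin (n + 1)) (y : Site 3 L) (i j : Fin 3), ‖su2Quat (plaquetteHolonomy (Us t) y i j) - 1‖ ≤ ε)
    (hTi : ∀ (i : Fin n) (e : Edge 3 L), ‖su2Quat (Us i.castSucc e) - su2Quat (Us i.succ e)‖ ≤ τ)
    (hTs : ∀ e : Edge 3 L, ‖su2Quat (Us (Fin.last n) e) - su2Quat (gaugeTransform g (Us 0) e)‖ ≤ τ) :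
    (∏ i : Fin n, transferKernel su2Rep β (Us i.castSucc) (Us i.succ)) *
        transferKernel su2Rep β (Us (Fin.last n)) (gaugeTransform g (TT.twist3 (fun _ => false) (Us 0))) ≤
      Real.exp (β * ((n + 1 : ℕ) * (Fintype.card (Plaquette 3 L) * ((|θ| * (2 * (L * ε) / σ)) ^ 2 + 2 * (|θ| * (2 * (L * ε) / σ)) * ε) +
          Fintype.card (Edge 3 L) * ((|θ| * (2 * (L * τ) / σ)) ^ 2 + 2 * (|θ| * (2 * (L * τ) / σ)) * τ)))) *
        ((∏ i : Fin n, transferKernel su2Rep β (ownShift θ (Us i.castSucc)) (ownShift θ (Us i.succ))) *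
          transferKernel su2Rep β (ownShift θ (Us (Fin.last n))) (gaugeTransform g (TT.twist3 (fun _ => false) (ownShift θ (Us 0))))) := by
  set bP : ℝ := (|θ| * (2 * (L * ε) / σ)) ^ 2 + 2 * (|θ| * (2 * (L * ε) / σ)) * ε with hbP
  set bT : ℝ := (|θ| * (2 * (L * τ) / σ)) ^ 2 + 2 * (|θ| * (2 * (L * τ) / σ)) * τ with hbT
  have h := TT.seamDensity_le_exp_mul (L := L) β (fun _ => false) Us (fun t => ownShift θ (Us t)) g
    (Q := β * ((n + 1 : ℕ) * (Fintype.card (Plaquette 3 L) * bP + Fintype.card (Edge 3 L) * bT))) ?_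
  · simpa only using h
  -- the exponent bound: actions up by ≤ #P bP per slice, couplings down by ≤ #E bT per bond
  simp only [TT.twist3_false]
  have hS : ∀ t : Fin (n + 1), wilsonAction su2Rep (ownShift θ (Us t)) - wilsonAction su2Rep (Us t) ≤ Fintype.card (Plaquette 3 L) * bP :=
    fun t => wilsonAction_ownShift_sub_le θ hσ (Us t) (hNC t) (hP t)
  have hTint : ∀ i : Fin n, timeCoupling su2Rep (Us i.castSucc) (Us i.succ) - Fintype.card (Edge 3 L) * bT ≤
      timeCoupling su2Rep (ownShift θ (Us i.castSucc)) (ownShift θ (Us i.succ)) :=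
    fun i => timeCoupling_ownShift_ge θ hσ _ _ (hNC _) (hNC _) (hTi i)
  have hTseam : timeCoupling su2Rep (Us (Fin.last n)) (gaugeTransform g (Us 0)) - Fintype.card (Edge 3 L) * bT ≤
      timeCoupling su2Rep (ownShift θ (Us (Fin.last n))) (gaugeTransform g (ownShift θ (Us 0))) := by
    rw [← ownShift_gaugeTransform]
    exact timeCoupling_ownShift_ge θ hσ _ _ (hNC _) (fun y hy => by rw [norm_imVec_lineHolonomy_gaugeTransform]; exact hNC 0 y hy) hTs
  have hsumS : ∑ t : Fin (n + 1), wilsonAction su2Rep (ownShift θ (Us t)) - ∑ t : Fin (n + 1), wilsonAction su2Rep (Us t) ≤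
      (n + 1 : ℕ) * (Fintype.card (Plaquette 3 L) * bP) := by
    rw [← Finset.sum_sub_distrib]
    exact (Finset.sum_le_card_nsmul _ _ (Fintype.card (Plaquette 3 L) * bP) fun t _ => hS t).trans (by simp)
  have hsumT : ∑ i : Fin n, timeCoupling su2Rep (Us i.castSucc) (Us i.succ) - ∑ i : Fin n, timeCoupling su2Rep (ownShift θ (Us i.castSucc)) (ownShift θ (Us i.succ)) ≤
      (n : ℕ) * (Fintype.card (Edge 3 L) * bT) := by
    rw [← Finset.sum_sub_distrib]
    exact (Finset.sum_le_card_nsmul _ _ (Fintype.card (Edge 3 L) * bT) fun i _ => by have := hTint i; linarith).trans (by simp)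
  have hkey : (∑ i : Fin n, timeCoupling su2Rep (Us i.castSucc) (Us i.succ)) + timeCoupling su2Rep (Us (Fin.last n)) (gaugeTransform g (Us 0))
        - ∑ t : Fin (n + 1), wilsonAction su2Rep (Us t)
      - ((∑ i : Fin n, timeCoupling su2Rep (ownShift θ (Us i.castSucc)) (ownShift θ (Us i.succ))) +
          timeCoupling su2Rep (ownShift θ (Us (Fin.last n))) (gaugeTransform g (ownShift θ (Us 0)))
        - ∑ t : Fin (n + 1), wilsonAction su2Rep (ownShift θ (Us t))) ≤
      (n + 1 : ℕ) * (Fintype.card (Plaquette 3 L) * bP) + ((n : ℕ) * (Fintype.card (Edge 3 L) * bT) + Fintype.card (Edge 3 L) * bT) := by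
    linarith [hsumS, hsumT, hTseam]
  have hring : ((n + 1 : ℕ) : ℝ) * (Fintype.card (Plaquette 3 L) * bP) + ((n : ℕ) * (Fintype.card (Edge 3 L) * bT) + Fintype.card (Edge 3 L) * bT) =
      (n + 1 : ℕ) * (Fintype.card (Plaquette 3 L) * bP + Fintype.card (Edge 3 L) * bT) := by push_cast; ring
  rw [hring] at hkey
  calc β * ((∑ i : Fin n, timeCoupling su2Rep (Us i.castSucc) (Us i.succ)) + timeCoupling su2Rep (Us (Fin.last n)) (gaugeTransform g (Us 0))) -
          β * ∑ t : Fin (n + 1), wilsonAction su2Rep (Us t) -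
        (β * ((∑ i : Fin n, timeCoupling su2Rep (ownShift θ (Us i.castSucc)) (ownShift θ (Us i.succ))) +
            timeCoupling su2Rep (ownShift θ (Us (Fin.last n))) (gaugeTransform g (ownShift θ (Us 0)))) -
          β * ∑ t : Fin (n + 1), wilsonAction su2Rep (ownShift θ (Us t)))
      = β * ((∑ i : Fin n, timeCoupling su2Rep (Us i.castSucc) (Us i.succ)) + timeCoupling su2Rep (Us (Fin.last n)) (gaugeTransform g (Us 0))
        - ∑ t : Fin (n + 1), wilsonAction su2Rep (Us t)
      - ((∑ i : Fin n, timeCoupling su2Rep (ownShift θ (Us i.castSucc)) (ownShift θ (Us i.succ))) +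
          timeCoupling su2Rep (ownShift θ (Us (Fin.last n))) (gaugeTransform g (ownShift θ (Us 0)))
        - ∑ t : Fin (n + 1), wilsonAction su2Rep (ownShift θ (Us t)))) := by ring
    _ ≤ β * ((n + 1 : ℕ) * (Fintype.card (Plaquette 3 L) * bP + Fintype.card (Edge 3 L) * bT)) := mul_le_mul_of_nonneg_left hkey hβ

end RingCost

end Summit.QuantumFields.YangMills.Theorems.FemtoTransferGap.OwnAxis

end
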